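import Mathlib.NumberTheory.Real.Irrational
import Mathlib.Analysis.Real.Sqrt
import Mathlib.Algebra.Order.Floor.Ring
import Mathlib.Data.Finset.Card
import Mathlib.Logic.Function.Iterate
import Mathlib.Tactic.LinearCombination
import Mathlib.Tactic.FieldSimp
import HarnessLib

/-!
# Reduced quadratic irrationals and the continued fraction step (the infrastructure of a real
# quadratic order, I)

Topic `NumberTheory/QuadraticFields`. Theorem-and-definition file (no named facts): the elementary
theory of the simple continued fraction (SCF) expansion of a real quadratic irrational
`φ = (P + √D)/Q` (`P, Q ∈ ℤ`, `D ∈ ℕ` not a square, `Q ∣ D − P²`), following Jacobson–Williams,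
*Solving the Pell Equation*, §3.1–§3.3, in the form needed for the *infrastructure* of the
principal class of a real quadratic order (op. cit. §5.3, §7.4) that underlies the regulator
algorithms (Shanks; Lenstra; Buchmann–Williams; Hallgren's quantum algorithm, Jozsa 2003 §6):

* `QuadIrr D` — the pair `(P, Q)`, with value `val = (P + √D)/Q` and conjugate `conj = (P − √D)/Q`;
  `IsAdmissible` (`Q ≠ 0`, `Q ∣ D − P²`), `IsReduced` (`Q > 0`, `Q ∣ D − P²`, `φ > 1`,
  `−1 < φ̄ < 0`, op. cit. (3.36));
* `step` — the SCF step `q = ⌊φ⌋`, `P' = qQ − P`, `Q' = (D − P'²)/Q` (op. cit. (3.11)), with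
  `val_step : φ' = 1/(φ − q)` and `conj_step : φ̄' = 1/(φ̄ − q)`;
* `IsPreReduced.isReduced_step`, `isReduced_step` — a (pre-)reduced quotient steps to a reduced one
  (op. cit. Prop. 3.4 and (3.36)), and
* the bounds `0 < P < √D`, `0 < Q < 2√D`, `√D < P + Q` for reduced quotients (op. cit. (3.32)).

Finiteness of the set of reduced quotients, injectivity of the step on it and pure periodicity
(op. cit. Thm. 3.8) are in the sequel `ReducedQuadraticIrrationalsCycle.lean`.

Jozsa's reduction operator `ρ` on reduced ideals `ℤ + ((b + √D)/2a)ℤ` (Jozsa 2003, §6.2–6.3) is this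
step with `P = b`, `Q = 2a` up to the rotation of the cycle by one place; we use the
Jacobson–Williams normalisation throughout. Mathlib has generalised continued fractions of a real
number (`GenContFract.of`) but not the `(P, Q)`-arithmetic of quadratic irrationals, reduction, or
periodicity (searched: `QuadIrr`, `purely periodic`, `reduced` + `continued fraction`).

## References

* M. J. Jacobson, Jr., H. C. Williams, *Solving the Pell Equation*, CMS Books in Mathematics,
  Springer (2009), §3.1 (3.2)–(3.11), §3.2, §3.3 Prop. 3.4, (3.32), (3.36), Thm. 3.8; §5.3.
  [JacobsonWilliams2008]
* R. Jozsa, *Notes on Hallgren's efficient quantum algorithm for solving Pell's equation*,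
  arXiv:quant-ph/0302134 (2003), §6. [Jozsa2003]
-/

noncomputable section

open scoped Classical

namespace Literature.NumberTheory.QuadraticFields

/-- A (formal) real quadratic irrational `(P + √D)/Q`, recorded by the pair of integers `(P, Q)`
(the "complete quotient" data of Jacobson–Williams, §3.1, (3.11)). [cite: JacobsonWilliams2008, §3.1 (3.11)] -/
@[ext]
structure QuadIrr (D : ℕ) where
  /-- the integer `P` of `(P + √D)/Q` -/
  P : ℤ
  /-- the integer `Q` of `(P + √D)/Q` -/
  Q : ℤ
deriving DecidableEq

namespace QuadIrr

variable {D : ℕ}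

/-- The real value `φ = (P + √D)/Q`. [cite: JacobsonWilliams2008, §3.1 (3.11)] -/
def val (x : QuadIrr D) : ℝ := (x.P + Real.sqrt D) / x.Q

/-- The conjugate `φ̄ = (P − √D)/Q`. [cite: JacobsonWilliams2008, §3.1 (conjugate, p. 45)] -/
def conj (x : QuadIrr D) : ℝ := (x.P - Real.sqrt D) / x.Q

/-- Admissible data: `Q ≠ 0` and `Q ∣ D − P²`. [cite: JacobsonWilliams2008, §3.3 (first paragraph)] -/
def IsAdmissible (x : QuadIrr D) : Prop := x.Q ≠ 0 ∧ x.Q ∣ (D : ℤ) - x.P ^ 2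

/-- Reduced quotient: `Q > 0`, `Q ∣ D − P²`, `φ > 1` and `−1 < φ̄ < 0`.
[cite: JacobsonWilliams2008, §3.3 (3.36) and Thm. 3.8] -/
def IsReduced (x : QuadIrr D) : Prop :=
  0 < x.Q ∧ x.Q ∣ (D : ℤ) - x.P ^ 2 ∧ 1 < x.val ∧ -1 < x.conj ∧ x.conj < 0

/-- Pre-reduced quotient: `Q > 0`, `Q ∣ D − P²`, `φ > 1` and `φ̄ < 0` (the hypothesis of Prop. 3.4;
e.g. `δ = (σ − 1 + √D)/σ`, whose expansion has a preperiod of length one).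
[cite: JacobsonWilliams2008, §3.3 Prop. 3.4] -/
def IsPreReduced (x : QuadIrr D) : Prop :=
  0 < x.Q ∧ x.Q ∣ (D : ℤ) - x.P ^ 2 ∧ 1 < x.val ∧ x.conj < 0

/-- The partial quotient `q = ⌊φ⌋`. [cite: JacobsonWilliams2008, §3.2 (q_i = ⌊φ_i⌋)] -/
def pq (x : QuadIrr D) : ℤ := ⌊x.val⌋

/-- The continued fraction step `(P, Q) ↦ (P', Q')`, `P' = qQ − P`, `Q' = (D − P'²)/Q`.
[cite: JacobsonWilliams2008, §3.1 (3.11)] -/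
def step (x : QuadIrr D) : QuadIrr D :=
  ⟨x.pq * x.Q - x.P, ((D : ℤ) - (x.pq * x.Q - x.P) ^ 2) / x.Q⟩

/-! ### Elementary identities -/

/-- `√D` is irrational when `D` is not a square. [folklore] -/
theorem irrational_sqrt (hD : ¬ IsSquare D) : Irrational (Real.sqrt D) :=
  irrational_sqrt_natCast_iff.mpr hD

/-- `(√D)² = D`. [folklore] -/
theorem sqrt_sq : Real.sqrt (D : ℝ) ^ 2 = D := Real.sq_sqrt (Nat.cast_nonneg D)

/-- `√D ≠ z` for every integer `z` when `D` is not a square. [folklore] -/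
theorem sqrt_ne_intCast (hD : ¬ IsSquare D) (z : ℤ) : Real.sqrt D ≠ z :=
  fun h => (irrational_sqrt hD).ne_int z h

/-- `0 < √D` when `D` is not a square. [folklore] -/
theorem sqrt_pos (hD : ¬ IsSquare D) : 0 < Real.sqrt (D : ℝ) := by
  rcases (Real.sqrt_nonneg (D : ℝ)).lt_or_eq with h | h
  · exact h
  · exact absurd h.symm (by exact_mod_cast sqrt_ne_intCast hD 0)

/-- `φ − φ̄ = 2√D/Q`. [cite: JacobsonWilliams2008, §3.3 (proof of (3.32))] -/
theorem val_sub_conj (x : QuadIrr D) : x.val - x.conj = 2 * Real.sqrt D / x.Q := by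
  unfold val conj; ring

/-- `φ + φ̄ = 2P/Q`. [cite: JacobsonWilliams2008, §3.3 (proof of (3.32))] -/
theorem val_add_conj (x : QuadIrr D) : x.val + x.conj = 2 * x.P / x.Q := by
  unfold val conj; ring

/-- The value of a quotient with `Q ≠ 0` is irrational. [folklore] -/
theorem irrational_val (hD : ¬ IsSquare D) {x : QuadIrr D} (hQ : x.Q ≠ 0) : Irrational x.val := by
  have h1 : Irrational (Real.sqrt D / (x.Q : ℝ)) := (irrational_sqrt hD).div_intCast hQ
  have h2 := Irrational.ratCast_add ((x.P : ℚ) / x.Q) h1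
  have hQ' : (x.Q : ℝ) ≠ 0 := by exact_mod_cast hQ
  convert h2 using 1
  unfold val; push_cast; field_simp

/-! ### The step -/

/-- `P' = qQ − P`. [cite: JacobsonWilliams2008, §3.1 (3.11)] -/
@[simp] theorem step_P (x : QuadIrr D) : (step x).P = x.pq * x.Q - x.P := rfl

/-- `Q ∣ D − P'²` for admissible data (as `P' ≡ −P (mod Q)`). [cite: JacobsonWilliams2008, §3.1 (3.11)] -/
theorem dvd_sub_step_P_sq {x : QuadIrr D} (h : x.IsAdmissible) :
    x.Q ∣ (D : ℤ) - (step x).P ^ 2 := by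
  have h2 := h.2
  rw [step_P]
  have : (D : ℤ) - (x.pq * x.Q - x.P) ^ 2 = ((D : ℤ) - x.P ^ 2) - x.Q * (x.pq ^ 2 * x.Q - 2 * x.pq * x.P) := by
    ring
  rw [this]
  exact dvd_sub h2 (dvd_mul_right _ _)

/-- `Q' · Q = D − P'²`. [cite: JacobsonWilliams2008, §3.1 (3.11)] -/
theorem step_Q_mul_Q {x : QuadIrr D} (h : x.IsAdmissible) :
    (step x).Q * x.Q = (D : ℤ) - (step x).P ^ 2 := by
  show ((D : ℤ) - (x.pq * x.Q - x.P) ^ 2) / x.Q * x.Q = (D : ℤ) - (x.pq * x.Q - x.P) ^ 2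
  exact Int.ediv_mul_cancel (dvd_sub_step_P_sq h)

/-- `D − P'² ≠ 0` (`D` is not a square). [folklore] -/
theorem sub_sq_ne_zero (hD : ¬ IsSquare D) (z : ℤ) : (D : ℤ) - z ^ 2 ≠ 0 := by
  intro h
  apply hD
  refine ⟨z.natAbs, ?_⟩
  have h1 : ((z.natAbs ^ 2 : ℕ) : ℤ) = (D : ℤ) := by rw [Nat.cast_pow, Int.natAbs_sq]; linarith
  have h2 : z.natAbs ^ 2 = D := by exact_mod_cast h1
  rw [← h2, sq]

/-- The step of admissible data is admissible. [cite: JacobsonWilliams2008, §3.1 (after (3.11))] -/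
theorem isAdmissible_step (hD : ¬ IsSquare D) {x : QuadIrr D} (h : x.IsAdmissible) :
    (step x).IsAdmissible := by
  refine ⟨fun h0 => ?_, ⟨x.Q, ?_⟩⟩
  · have := step_Q_mul_Q h
    rw [h0, zero_mul] at this
    exact sub_sq_ne_zero hD _ this.symm
  · rw [← step_Q_mul_Q h]

/-- `φ − q = (√D − P')/Q`. [cite: JacobsonWilliams2008, §3.1 (3.2) with (3.11)] -/
theorem val_sub_pq {x : QuadIrr D} (hQ : x.Q ≠ 0) :
    x.val - x.pq = (Real.sqrt D - (step x).P) / x.Q := by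
  have hQ' : (x.Q : ℝ) ≠ 0 := by exact_mod_cast hQ
  rw [step_P]; unfold val; push_cast
  field_simp; ring

/-- **The value of the step: `φ' = 1/(φ − q)`** (op. cit. (3.2)). [cite: JacobsonWilliams2008, §3.1 (3.2), (3.11)] -/
theorem val_step (hD : ¬ IsSquare D) {x : QuadIrr D} (h : x.IsAdmissible) :
    (step x).val = 1 / (x.val - x.pq) := by
  rw [val_sub_pq h.1, one_div_div]
  have hmul : ((step x).Q : ℝ) * x.Q = D - ((step x).P : ℝ) ^ 2 := by exact_mod_cast step_Q_mul_Q h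
  have hne : Real.sqrt D - ((step x).P : ℝ) ≠ 0 := sub_ne_zero.mpr (sqrt_ne_intCast hD _)
  have hQ' : ((step x).Q : ℝ) ≠ 0 := by exact_mod_cast (isAdmissible_step hD h).1
  unfold val
  rw [div_eq_div_iff hQ' hne]
  linear_combination sqrt_sq (D := D) - hmul

/-- **The conjugate of the step: `φ̄' = 1/(φ̄ − q)`.** [cite: JacobsonWilliams2008, §3.3 (proof of Prop. 3.4)] -/
theorem conj_step (hD : ¬ IsSquare D) {x : QuadIrr D} (h : x.IsAdmissible) :
    (step x).conj = 1 / (x.conj - x.pq) := by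
  have hQ : (x.Q : ℝ) ≠ 0 := by exact_mod_cast h.1
  have hmul : ((step x).Q : ℝ) * x.Q = D - ((step x).P : ℝ) ^ 2 := by exact_mod_cast step_Q_mul_Q h
  have hne' : Real.sqrt D + ((step x).P : ℝ) ≠ 0 := by
    have := sqrt_ne_intCast hD (-(step x).P)
    push_cast at this
    intro h0
    exact this (by linarith)
  have hQ' : ((step x).Q : ℝ) ≠ 0 := by exact_mod_cast (isAdmissible_step hD h).1
  have hcq : x.conj - x.pq = -(Real.sqrt D + (step x).P) / x.Q := by
    rw [step_P]; unfold conj; push_cast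
    field_simp; ring
  rw [hcq, one_div_div]
  unfold conj
  rw [div_eq_div_iff hQ' (neg_ne_zero.mpr hne')]
  linear_combination sqrt_sq (D := D) - hmul

/-! ### Reduced quotients -/

/-- A reduced quotient is pre-reduced. [cite: JacobsonWilliams2008, §3.3 (3.36)] -/
theorem IsReduced.isPreReduced {x : QuadIrr D} (h : x.IsReduced) : x.IsPreReduced :=
  ⟨h.1, h.2.1, h.2.2.1, h.2.2.2.2⟩

/-- A pre-reduced quotient is admissible. [cite: JacobsonWilliams2008, §3.3 Prop. 3.4] -/
theorem IsPreReduced.isAdmissible {x : QuadIrr D} (h : x.IsPreReduced) : x.IsAdmissible :=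
  ⟨h.1.ne', h.2.1⟩

/-- A reduced quotient is admissible. [cite: JacobsonWilliams2008, §3.3 (3.36)] -/
theorem IsReduced.isAdmissible {x : QuadIrr D} (h : x.IsReduced) : x.IsAdmissible :=
  h.isPreReduced.isAdmissible

/-- For a pre-reduced quotient, `q = ⌊φ⌋ ≥ 1`. [cite: JacobsonWilliams2008, §3.2 (q_i ≥ 1)] -/
theorem IsPreReduced.one_le_pq {x : QuadIrr D} (h : x.IsPreReduced) : 1 ≤ x.pq := by
  have : (1 : ℝ) ≤ x.val := h.2.2.1.le
  have := Int.floor_mono this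
  simpa [pq] using this

/-- For a reduced quotient, `q = ⌊φ⌋ ≥ 1`. [cite: JacobsonWilliams2008, §3.2 (q_i ≥ 1)] -/
theorem IsReduced.one_le_pq {x : QuadIrr D} (h : x.IsReduced) : 1 ≤ x.pq :=
  h.isPreReduced.one_le_pq

/-- For a reduced quotient, `P < √D` (from `φ̄ < 0`). [cite: JacobsonWilliams2008, §3.3 (3.32)] -/
theorem IsReduced.P_lt_sqrt {x : QuadIrr D} (h : x.IsReduced) : (x.P : ℝ) < Real.sqrt D := by
  have hQ : (0 : ℝ) < x.Q := by exact_mod_cast h.1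
  have hc := h.2.2.2.2
  unfold conj at hc
  rw [div_neg_iff] at hc
  rcases hc with ⟨_, h2⟩ | ⟨h1, _⟩
  · linarith
  · linarith

/-- For a reduced quotient, `√D < P + Q` (from `−1 < φ̄`). [cite: JacobsonWilliams2008, §3.3 (3.32)] -/
theorem IsReduced.sqrt_lt_P_add_Q {x : QuadIrr D} (h : x.IsReduced) :
    Real.sqrt D < (x.P : ℝ) + x.Q := by
  have hQ : (0 : ℝ) < x.Q := by exact_mod_cast h.1
  have hc := h.2.2.2.1
  unfold conj at hc
  rw [lt_div_iff₀ hQ] at hc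
  linarith

/-- For a reduced quotient, `Q < P + √D` (from `φ > 1`). [cite: JacobsonWilliams2008, §3.3 (3.32)] -/
theorem IsReduced.Q_lt_P_add_sqrt {x : QuadIrr D} (h : x.IsReduced) :
    (x.Q : ℝ) < x.P + Real.sqrt D := by
  have hQ : (0 : ℝ) < x.Q := by exact_mod_cast h.1
  have hv := h.2.2.1
  unfold val at hv
  rw [lt_div_iff₀ hQ] at hv
  linarith

/-- For a reduced quotient, `0 < P` (add `φ > 1` and `φ̄ > −1`). [cite: JacobsonWilliams2008, §3.3 (3.32)] -/
theorem IsReduced.P_pos {x : QuadIrr D} (h : x.IsReduced) : 0 < x.P := by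
  have h1 := h.sqrt_lt_P_add_Q
  have h2 := h.Q_lt_P_add_sqrt
  have : (0 : ℝ) < x.P := by linarith
  exact_mod_cast this

/-- For a reduced quotient, `Q < 2√D`. [cite: JacobsonWilliams2008, §3.3 (3.32)] -/
theorem IsReduced.Q_lt_two_sqrt {x : QuadIrr D} (h : x.IsReduced) :
    (x.Q : ℝ) < 2 * Real.sqrt D := by
  linarith [h.Q_lt_P_add_sqrt, h.P_lt_sqrt]

/-- Integer bounds for a reduced quotient: `1 ≤ P ≤ ⌊√D⌋` and `1 ≤ Q ≤ 2⌊√D⌋ + 1`.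
[cite: JacobsonWilliams2008, §3.3 (3.32)] -/
theorem IsReduced.bounds {x : QuadIrr D} (h : x.IsReduced) :
    1 ≤ x.P ∧ x.P ≤ Nat.sqrt D ∧ 1 ≤ x.Q ∧ x.Q ≤ 2 * Nat.sqrt D + 1 := by
  have hs : Real.sqrt (D : ℝ) < Nat.sqrt D + 1 := Real.real_sqrt_lt_nat_sqrt_succ
  refine ⟨h.P_pos, ?_, h.1, ?_⟩
  · have : (x.P : ℝ) < Nat.sqrt D + 1 := h.P_lt_sqrt.trans hs
    have : x.P < (Nat.sqrt D : ℤ) + 1 := by exact_mod_cast this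
    omega
  · have : (x.Q : ℝ) < 2 * (Nat.sqrt D + 1) := by linarith [h.Q_lt_two_sqrt]
    have : x.Q < 2 * ((Nat.sqrt D : ℤ) + 1) := by exact_mod_cast this
    omega

/-- **A pre-reduced quotient steps to a reduced quotient** (Prop. 3.4 with (3.36):
`φ' = 1/(φ − ⌊φ⌋) > 1` because `φ` is irrational, and `φ̄' = 1/(φ̄ − q) ∈ (−1, 0)` because
`φ̄ < 0 < 1 ≤ q`). [cite: JacobsonWilliams2008, §3.3 Prop. 3.4] -/
theorem IsPreReduced.isReduced_step (hD : ¬ IsSquare D) {x : QuadIrr D} (h : x.IsPreReduced) :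
    (step x).IsReduced := by
  have hadm := h.isAdmissible
  have hadm' := isAdmissible_step hD hadm
  have hq : (1 : ℝ) ≤ x.pq := by exact_mod_cast h.one_le_pq
  -- the new value exceeds 1
  have hfrac_pos : 0 < x.val - x.pq := by
    have h0 : (x.pq : ℝ) ≤ x.val := Int.floor_le _
    rcases h0.lt_or_eq with hlt | heq
    · linarith
    · exact absurd heq.symm ((irrational_val hD hadm.1).ne_int _)
  have hfrac_lt : x.val - x.pq < 1 := by
    have := Int.lt_floor_add_one x.val
    simp only [pq]
    linarith
  have hval' : 1 < (step x).val := by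
    rw [val_step hD hadm]
    exact one_lt_one_div hfrac_pos hfrac_lt
  -- the new conjugate lies in (−1, 0)
  have hc0 : x.conj < 0 := h.2.2.2
  have hden : x.conj - x.pq < -1 := by linarith
  have hdneg : x.conj - x.pq < 0 := by linarith
  have hconj' : -1 < (step x).conj ∧ (step x).conj < 0 := by
    rw [conj_step hD hadm]
    constructor
    · rw [lt_div_iff_of_neg hdneg]
      linarith
    · exact div_neg_of_pos_of_neg one_pos hdneg
  -- hence `Q' > 0`
  have hQ' : 0 < (step x).Q := by
    have hsub := val_sub_conj (step x)
    have hpos : 0 < (step x).val - (step x).conj := by linarith [hconj'.2]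
    rw [hsub] at hpos
    have hs := sqrt_pos hD
    rcases lt_or_gt_of_ne hadm'.1 with hneg | hpos'
    · have hneg' : ((step x).Q : ℝ) < 0 := by exact_mod_cast hneg
      have : 2 * Real.sqrt D / ((step x).Q : ℝ) < 0 := div_neg_of_pos_of_neg (by linarith) hneg'
      linarith
    · exact hpos'
  exact ⟨hQ', hadm'.2, hval', hconj'.1, hconj'.2⟩

/-- **A reduced quotient steps to a reduced quotient.** [cite: JacobsonWilliams2008, §3.3 Prop. 3.4 with (3.36)] -/
theorem isReduced_step (hD : ¬ IsSquare D) {x : QuadIrr D} (h : x.IsReduced) : (step x).IsReduced :=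
  h.isPreReduced.isReduced_step hD

/-- Iterates of the step of a reduced quotient are reduced. [cite: JacobsonWilliams2008, §3.3 Prop. 3.4] -/
theorem isReduced_iterate (hD : ¬ IsSquare D) {x : QuadIrr D} (h : x.IsReduced) (n : ℕ) :
    (step^[n] x).IsReduced := by
  induction n with
  | zero => exact h
  | succ n ih => rw [Function.iterate_succ_apply']; exact isReduced_step hD ih

end QuadIrr

end Literature.NumberTheory.QuadraticFields

end
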